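import Summits.AtomisticToContinuum.Crystallization.Theorems.ExcessDecayLiouvilleHcpLiouvilleBlowdownDifferences
import Summits.AtomisticToContinuum.Crystallization.Theorems.ExcessDecayLiouvilleHcpLiouvilleBlowdownLatticeSobolev

/-!
# `ExcessDecayLiouville.HcpLiouville` (stmt-AtomisticToContinuum-9332), line `Sketch` (skeleton v4): the Sobolev step of the interior estimate

Helper for stub `stub_interior` (step (5) of the interior estimate for `L`-harmonic fields): the landed lattice Sobolev
inequality `blowdown_latticeSobolev3` (D3) applied to the generator difference `G = F(· + A e₀) − F` of a field `F` and
to its cross difference `G× = 𝟙_{S₀}·(F(· + (t 1 − t 0)) − F)`; each of the eight sums of D3 is a sum of squared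
lattice differences of ONE of the iterated difference fields `D_{e_k}⋯D_{e_1} F` (`k ≤ 3`, generators
`e_i ∈ {u₁, u₂, w₃}`) and is dominated by its nearest-neighbour energy (`…BlowdownDifferences`).  Output
(`blowdown_sobolevGen`, registered; the cross difference is in …BlowdownSobolevCross): pointwise bounds for the generator and cross differences of `F` on the sites of
`B_ℓ(c)` by `C·(ℓ⁻³B₀ + ℓ⁻¹B₁ + ℓB₂ + ℓ³B₃)`, where `B_k` bounds the energies of the `k`-fold differences on `B_{5ℓ+2}(c)`.
All `[folklore]`; a `--supports` helper for item stmt-AtomisticToContinuum-9332, nothing here closes an item.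
-/

noncomputable section

namespace Summit.AtomisticToContinuum.Crystallization.Theorems.ExcessDecayLiouville

open scoped BigOperators Topology Classical InnerProductSpace RealInnerProductSpace
open Literature.MathematicalPhysics.StatisticalMechanics
open Summit.AtomisticToContinuum.Crystallization.Theses.ExcessDecayLiouville
open Summit.AtomisticToContinuum.Crystallization.Theorems.PhononStabilityNegative

namespace Blowdown

open LevelOne

variable {t : Fin 2 → (EuclideanSpace ℝ (Fin 3))}
  {A : (EuclideanSpace ℝ (Fin 3)) →L[ℝ] (EuclideanSpace ℝ (Fin 3))}

/-! ## Finite-sum forms of the ball sums of D3 -/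

/-- A ball sum of a `Finset` sum over the generators is at most `3 × ` a common bound of the ball sums. [folklore] -/
theorem tsum_ball_finset_sum_le (hA : Adm₀ A) (hI : Inner₀ t A) (c : EuclideanSpace ℝ (Fin 3)) (ρ : ℝ)
    (gens : Finset (EuclideanSpace ℝ (Fin 3))) (hcard : gens.card ≤ 3)
    (f : EuclideanSpace ℝ (Fin 3) → EuclideanSpace ℝ (Fin 3) → ℝ) {B : ℝ} (hB : 0 ≤ B)
    (h : ∀ e ∈ gens, ∑' p : {s : EuclideanSpace ℝ (Fin 3) // s ∈ Sites₀ t A ∧ dist s c ≤ ρ}, f e p ≤ B) :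
    ∑' p : {s : EuclideanSpace ℝ (Fin 3) // s ∈ Sites₀ t A ∧ dist s c ≤ ρ}, ∑ e ∈ gens, f e p ≤ 3 * B := by
  rw [tsum_ball_eq_sum hA hI c ρ (fun x => ∑ e ∈ gens, f e x), Finset.sum_comm]
  have h' : ∀ e ∈ gens, ∑ p ∈ (finite_sites_ball hA hI c ρ).toFinset, f e p ≤ B := fun e he => by
    rw [← tsum_ball_eq_sum hA hI c ρ (fun x => f e x)]; exact h e he
  calc ∑ e ∈ gens, ∑ p ∈ (finite_sites_ball hA hI c ρ).toFinset, f e p ≤ ∑ e ∈ gens, B := Finset.sum_le_sum h'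
    _ = gens.card * B := by rw [Finset.sum_const, nsmul_eq_mul]
    _ ≤ 3 * B := mul_le_mul_of_nonneg_right (by exact_mod_cast hcard) hB

/-! ## The generator difference -/

/-- **Sobolev bound for a generator difference**: the four sums of D3 for `G = F(· + A e₀) − F` are sums of squared
generator differences of `F`, `D_{e₀}F`, `D_e D_{e₀} F`, `D_{e′} D_e D_{e₀} F`, hence `≤ 4B₀, 12B₁, 36B₂, 108B₃`.
[folklore] -/
theorem sobolev_sums_gen (hA : Adm₀ A) (hI : Inner₀ t A) (F : EuclideanSpace ℝ (Fin 3) → EuclideanSpace ℝ (Fin 3))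
    (c : EuclideanSpace ℝ (Fin 3)) {ℓ B₀ B₁ B₂ B₃ : ℝ} (gens : Finset (EuclideanSpace ℝ (Fin 3)))
    (hgens : gens = {triangularVec₁ 1, triangularVec₂ 1, layerNormal (2 * Real.sqrt (2 / 3))})
    {e₀ : EuclideanSpace ℝ (Fin 3)} (he₀ : e₀ ∈ gens)
    (hB0 : nnEnergy (Sites₀ t A) F c (5 * ℓ + 2) ≤ B₀)
    (hB1 : ∀ e₁ ∈ gens, nnEnergy (Sites₀ t A) (fun x => F (x + A e₁) - F x) c (5 * ℓ + 2) ≤ B₁)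
    (hB2 : ∀ e₁ ∈ gens, ∀ e₂ ∈ gens,
      nnEnergy (Sites₀ t A) (fun x => (F (x + A e₂ + A e₁) - F (x + A e₂)) - (F (x + A e₁) - F x)) c (5 * ℓ + 2) ≤ B₂)
    (hB3 : ∀ e₁ ∈ gens, ∀ e₂ ∈ gens, ∀ e₃ ∈ gens,
      nnEnergy (Sites₀ t A) (fun x => ((F (x + A e₃ + A e₂ + A e₁) - F (x + A e₃ + A e₂)) -
        (F (x + A e₃ + A e₁) - F (x + A e₃))) - ((F (x + A e₂ + A e₁) - F (x + A e₂)) - (F (x + A e₁) - F x)))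
        c (5 * ℓ + 2) ≤ B₃) :
    (∑' p : {s : EuclideanSpace ℝ (Fin 3) // s ∈ Sites₀ t A ∧ dist s c ≤ 5 * ℓ},
        ‖F ((p : EuclideanSpace ℝ (Fin 3)) + A e₀) - F p‖ ^ 2 ≤ 4 * B₀) ∧
    (∑' p : {s : EuclideanSpace ℝ (Fin 3) // s ∈ Sites₀ t A ∧ dist s c ≤ 5 * ℓ}, ∑ e ∈ gens,
        ‖(F ((p : EuclideanSpace ℝ (Fin 3)) + A e + A e₀) - F ((p : EuclideanSpace ℝ (Fin 3)) + A e)) -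
          (F ((p : EuclideanSpace ℝ (Fin 3)) + A e₀) - F p)‖ ^ 2 ≤ 3 * (4 * B₁)) ∧
    (∑' p : {s : EuclideanSpace ℝ (Fin 3) // s ∈ Sites₀ t A ∧ dist s c ≤ 5 * ℓ}, ∑ e ∈ gens, ∑ e' ∈ gens,
        ‖(F ((p : EuclideanSpace ℝ (Fin 3)) + A e + A e' + A e₀) - F ((p : EuclideanSpace ℝ (Fin 3)) + A e + A e')) -
          (F ((p : EuclideanSpace ℝ (Fin 3)) + A e + A e₀) - F ((p : EuclideanSpace ℝ (Fin 3)) + A e)) -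
          ((F ((p : EuclideanSpace ℝ (Fin 3)) + A e' + A e₀) - F ((p : EuclideanSpace ℝ (Fin 3)) + A e')) -
            (F ((p : EuclideanSpace ℝ (Fin 3)) + A e₀) - F p))‖ ^ 2 ≤ 3 * (3 * (4 * B₂))) ∧
    (∑' p : {s : EuclideanSpace ℝ (Fin 3) // s ∈ Sites₀ t A ∧ dist s c ≤ 5 * ℓ}, ∑ e ∈ gens, ∑ e' ∈ gens, ∑ e'' ∈ gens,
        ‖((F ((p : EuclideanSpace ℝ (Fin 3)) + A e + A e' + A e'' + A e₀) - F ((p : EuclideanSpace ℝ (Fin 3)) + A e + A e' + A e'')) -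
            (F ((p : EuclideanSpace ℝ (Fin 3)) + A e + A e' + A e₀) - F ((p : EuclideanSpace ℝ (Fin 3)) + A e + A e')) -
          ((F ((p : EuclideanSpace ℝ (Fin 3)) + A e + A e'' + A e₀) - F ((p : EuclideanSpace ℝ (Fin 3)) + A e + A e'')) -
            (F ((p : EuclideanSpace ℝ (Fin 3)) + A e + A e₀) - F ((p : EuclideanSpace ℝ (Fin 3)) + A e)))) -
          (((F ((p : EuclideanSpace ℝ (Fin 3)) + A e' + A e'' + A e₀) - F ((p : EuclideanSpace ℝ (Fin 3)) + A e' + A e'')) -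
            (F ((p : EuclideanSpace ℝ (Fin 3)) + A e' + A e₀) - F ((p : EuclideanSpace ℝ (Fin 3)) + A e'))) -
          ((F ((p : EuclideanSpace ℝ (Fin 3)) + A e'' + A e₀) - F ((p : EuclideanSpace ℝ (Fin 3)) + A e'')) -
            (F ((p : EuclideanSpace ℝ (Fin 3)) + A e₀) - F p)))‖ ^ 2 ≤ 3 * (3 * (3 * (4 * B₃)))) := by
  have hgen : ∀ {e : EuclideanSpace ℝ (Fin 3)}, e ∈ gens →
      e ∈ ({triangularVec₁ 1, triangularVec₂ 1, layerNormal (2 * Real.sqrt (2 / 3))} :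
        Finset (EuclideanSpace ℝ (Fin 3))) := fun he => by rwa [hgens] at he
  have hcard : gens.card ≤ 3 := by rw [hgens]; exact Finset.card_le_three
  have hE0 : ∀ (H : EuclideanSpace ℝ (Fin 3) → EuclideanSpace ℝ (Fin 3)) (r : ℝ), 0 ≤ nnEnergy (Sites₀ t A) H c r :=
    fun H r => nnEnergy_nonneg _ _ _ _
  have hB1' : 0 ≤ B₁ := (hE0 _ _).trans (hB1 e₀ he₀)
  have hB2' : 0 ≤ B₂ := (hE0 _ _).trans (hB2 e₀ he₀ e₀ he₀)
  have hB3' : 0 ≤ B₃ := (hE0 _ _).trans (hB3 e₀ he₀ e₀ he₀ e₀ he₀)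
  have h52 : (5 * ℓ) + 2 = 5 * ℓ + 2 := rfl
  refine ⟨?_, ?_, ?_, ?_⟩
  · exact (tsum_ball_genDiff_sq_le hA hI F c (5 * ℓ) (hgen he₀)).trans (by linarith [hB0])
  · refine tsum_ball_finset_sum_le hA hI c (5 * ℓ) gens hcard
      (fun e x => ‖(F (x + A e + A e₀) - F (x + A e)) - (F (x + A e₀) - F x)‖ ^ 2) (B := 4 * B₁) (by linarith) fun e he => ?_
    have h := tsum_ball_genDiff_sq_le hA hI (fun x => F (x + A e₀) - F x) c (5 * ℓ) (hgen he)
    exact h.trans (by linarith [hB1 e₀ he₀])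
  · refine tsum_ball_finset_sum_le hA hI c (5 * ℓ) gens hcard
      (fun e x => ∑ e' ∈ gens, ‖(F (x + A e + A e' + A e₀) - F (x + A e + A e')) - (F (x + A e + A e₀) - F (x + A e)) - ((F (x + A e' + A e₀) - F (x + A e')) - (F (x + A e₀) - F x))‖ ^ 2) (B := 3 * (4 * B₂)) (by linarith) fun e he => ?_
    refine tsum_ball_finset_sum_le hA hI c (5 * ℓ) gens hcard
      (fun e' x => ‖(F (x + A e + A e' + A e₀) - F (x + A e + A e')) - (F (x + A e + A e₀) - F (x + A e)) - ((F (x + A e' + A e₀) - F (x + A e')) - (F (x + A e₀) - F x))‖ ^ 2) (B := 4 * B₂) (by linarith) fun e' he' => ?_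
    have h := tsum_ball_genDiff_sq_le hA hI (fun x => (F (x + A e + A e₀) - F (x + A e)) - (F (x + A e₀) - F x))
      c (5 * ℓ) (hgen he')
    refine (le_of_eq (tsum_congr fun p => ?_)).trans (h.trans (by linarith [hB2 e₀ he₀ e he]))
    have e1 : (p : EuclideanSpace ℝ (Fin 3)) + A e + A e' = (p : EuclideanSpace ℝ (Fin 3)) + A e' + A e := by abel
    rw [e1]
    congr 2
    abel
  · refine tsum_ball_finset_sum_le hA hI c (5 * ℓ) gens hcard
      (fun e x => ∑ e' ∈ gens, ∑ e'' ∈ gens, ‖((F (x + A e + A e' + A e'' + A e₀) - F (x + A e + A e' + A e'')) - (F (x + A e + A e' + A e₀) - F (x + A e + A e')) - ((F (x + A e + A e'' + A e₀) - F (x + A e + A e'')) - (F (x + A e + A e₀) - F (x + A e)))) - (((F (x + A e' + A e'' + A e₀) - F (x + A e' + A e'')) - (F (x + A e' + A e₀) - F (x + A e'))) - ((F (x + A e'' + A e₀) - F (x + A e'')) - (F (x + A e₀) - F x)))‖ ^ 2) (B := 3 * (3 * (4 * B₃))) (by linarith) fun e he => ?_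
    refine tsum_ball_finset_sum_le hA hI c (5 * ℓ) gens hcard
      (fun e' x => ∑ e'' ∈ gens, ‖((F (x + A e + A e' + A e'' + A e₀) - F (x + A e + A e' + A e'')) - (F (x + A e + A e' + A e₀) - F (x + A e + A e')) - ((F (x + A e + A e'' + A e₀) - F (x + A e + A e'')) - (F (x + A e + A e₀) - F (x + A e)))) - (((F (x + A e' + A e'' + A e₀) - F (x + A e' + A e'')) - (F (x + A e' + A e₀) - F (x + A e'))) - ((F (x + A e'' + A e₀) - F (x + A e'')) - (F (x + A e₀) - F x)))‖ ^ 2) (B := 3 * (4 * B₃)) (by linarith) fun e' he' => ?_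
    refine tsum_ball_finset_sum_le hA hI c (5 * ℓ) gens hcard
      (fun e'' x => ‖((F (x + A e + A e' + A e'' + A e₀) - F (x + A e + A e' + A e'')) - (F (x + A e + A e' + A e₀) - F (x + A e + A e')) - ((F (x + A e + A e'' + A e₀) - F (x + A e + A e'')) - (F (x + A e + A e₀) - F (x + A e)))) - (((F (x + A e' + A e'' + A e₀) - F (x + A e' + A e'')) - (F (x + A e' + A e₀) - F (x + A e'))) - ((F (x + A e'' + A e₀) - F (x + A e'')) - (F (x + A e₀) - F x)))‖ ^ 2) (B := 4 * B₃) (by linarith) fun e'' he'' => ?_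
    have h := tsum_ball_genDiff_sq_le hA hI (fun x => ((F (x + A e' + A e + A e₀) - F (x + A e' + A e)) -
      (F (x + A e' + A e₀) - F (x + A e'))) - ((F (x + A e + A e₀) - F (x + A e)) - (F (x + A e₀) - F x)))
      c (5 * ℓ) (hgen he'')
    refine (le_of_eq (tsum_congr fun p => ?_)).trans (h.trans (by linarith [hB3 e₀ he₀ e he e' he']))
    have e1 : (p : EuclideanSpace ℝ (Fin 3)) + A e + A e' + A e'' = (p : EuclideanSpace ℝ (Fin 3)) + A e'' + A e' + A e := by
      abel
    have e2 : (p : EuclideanSpace ℝ (Fin 3)) + A e + A e'' = (p : EuclideanSpace ℝ (Fin 3)) + A e'' + A e := by abel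
    have e3 : (p : EuclideanSpace ℝ (Fin 3)) + A e' + A e'' = (p : EuclideanSpace ℝ (Fin 3)) + A e'' + A e' := by abel
    have e4 : (p : EuclideanSpace ℝ (Fin 3)) + A e + A e' = (p : EuclideanSpace ℝ (Fin 3)) + A e' + A e := by abel
    rw [e1, e2, e3, e4]
    congr 2
    abel

/-- **The generator difference, pointwise**: for `e₀ ∈ {u₁,u₂,w₃}` and a site `p₀ ∈ B_ℓ(c)` (`ℓ ≥ 8`),
`‖F(p₀ + Ae₀) − F p₀‖² ≤ C_S·(ℓ⁻³·4B₀ + ℓ⁻¹·12B₁ + ℓ·36B₂ + ℓ³·108B₃)` with the constant `C_S` of D3. [folklore] -/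
theorem genDiff_sq_le (hA : Adm₀ A) (hI : Inner₀ t A) {C_S : ℝ}
    (hS : ∀ (G : EuclideanSpace ℝ (Fin 3) → EuclideanSpace ℝ (Fin 3)) (c : EuclideanSpace ℝ (Fin 3)) (ℓ : ℝ), 8 ≤ ℓ →
      ∀ p₀ ∈ Sites₀ t A, dist p₀ c ≤ ℓ → ‖G p₀‖ ^ 2 ≤ C_S * ((ℓ⁻¹) ^ 3 *
        ∑' p : {s : EuclideanSpace ℝ (Fin 3) // s ∈ Sites₀ t A ∧ dist s c ≤ 5 * ℓ}, ‖G p‖ ^ 2 +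
        ℓ⁻¹ * ∑' p : {s : EuclideanSpace ℝ (Fin 3) // s ∈ Sites₀ t A ∧ dist s c ≤ 5 * ℓ},
          ∑ e ∈ ({triangularVec₁ 1, triangularVec₂ 1, layerNormal (2 * Real.sqrt (2 / 3))} :
            Finset (EuclideanSpace ℝ (Fin 3))), ‖G (p + A e) - G p‖ ^ 2 +
        ℓ * ∑' p : {s : EuclideanSpace ℝ (Fin 3) // s ∈ Sites₀ t A ∧ dist s c ≤ 5 * ℓ},
          ∑ e ∈ ({triangularVec₁ 1, triangularVec₂ 1, layerNormal (2 * Real.sqrt (2 / 3))} :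
            Finset (EuclideanSpace ℝ (Fin 3))),
          ∑ e' ∈ ({triangularVec₁ 1, triangularVec₂ 1, layerNormal (2 * Real.sqrt (2 / 3))} :
            Finset (EuclideanSpace ℝ (Fin 3))), ‖G (p + A e + A e') - G (p + A e) - G (p + A e') + G p‖ ^ 2 +
        ℓ ^ 3 * ∑' p : {s : EuclideanSpace ℝ (Fin 3) // s ∈ Sites₀ t A ∧ dist s c ≤ 5 * ℓ},
          ∑ e ∈ ({triangularVec₁ 1, triangularVec₂ 1, layerNormal (2 * Real.sqrt (2 / 3))} :
            Finset (EuclideanSpace ℝ (Fin 3))),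
          ∑ e' ∈ ({triangularVec₁ 1, triangularVec₂ 1, layerNormal (2 * Real.sqrt (2 / 3))} :
            Finset (EuclideanSpace ℝ (Fin 3))),
          ∑ e'' ∈ ({triangularVec₁ 1, triangularVec₂ 1, layerNormal (2 * Real.sqrt (2 / 3))} :
            Finset (EuclideanSpace ℝ (Fin 3))),
            ‖G (p + A e + A e' + A e'') - G (p + A e + A e') - G (p + A e + A e'') - G (p + A e' + A e'') +
              G (p + A e) + G (p + A e') + G (p + A e'') - G p‖ ^ 2))
    (hC : 0 ≤ C_S) (F : EuclideanSpace ℝ (Fin 3) → EuclideanSpace ℝ (Fin 3)) (c : EuclideanSpace ℝ (Fin 3))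
    {ℓ B₀ B₁ B₂ B₃ : ℝ} (hℓ : 8 ≤ ℓ) (gens : Finset (EuclideanSpace ℝ (Fin 3)))
    (hgens : gens = {triangularVec₁ 1, triangularVec₂ 1, layerNormal (2 * Real.sqrt (2 / 3))})
    {e₀ : EuclideanSpace ℝ (Fin 3)} (he₀ : e₀ ∈ gens)
    (hB0 : nnEnergy (Sites₀ t A) F c (5 * ℓ + 2) ≤ B₀)
    (hB1 : ∀ e₁ ∈ gens, nnEnergy (Sites₀ t A) (fun x => F (x + A e₁) - F x) c (5 * ℓ + 2) ≤ B₁)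
    (hB2 : ∀ e₁ ∈ gens, ∀ e₂ ∈ gens,
      nnEnergy (Sites₀ t A) (fun x => (F (x + A e₂ + A e₁) - F (x + A e₂)) - (F (x + A e₁) - F x)) c (5 * ℓ + 2) ≤ B₂)
    (hB3 : ∀ e₁ ∈ gens, ∀ e₂ ∈ gens, ∀ e₃ ∈ gens,
      nnEnergy (Sites₀ t A) (fun x => ((F (x + A e₃ + A e₂ + A e₁) - F (x + A e₃ + A e₂)) -
        (F (x + A e₃ + A e₁) - F (x + A e₃))) - ((F (x + A e₂ + A e₁) - F (x + A e₂)) - (F (x + A e₁) - F x)))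
        c (5 * ℓ + 2) ≤ B₃)
    {p₀ : EuclideanSpace ℝ (Fin 3)} (hp₀ : p₀ ∈ Sites₀ t A) (hp₀c : dist p₀ c ≤ ℓ) :
    ‖F (p₀ + A e₀) - F p₀‖ ^ 2 ≤
      C_S * ((ℓ⁻¹) ^ 3 * (4 * B₀) + ℓ⁻¹ * (3 * (4 * B₁)) + ℓ * (3 * (3 * (4 * B₂))) + ℓ ^ 3 * (3 * (3 * (3 * (4 * B₃))))) := by
  obtain ⟨h0, h1, h2, h3⟩ := sobolev_sums_gen hA hI F c gens hgens he₀ hB0 hB1 hB2 hB3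
  have hmain := hS (fun x => F (x + A e₀) - F x) c ℓ hℓ p₀ hp₀ hp₀c
  rw [← hgens] at hmain
  have hℓ0 : 0 < ℓ := by linarith
  refine hmain.trans (mul_le_mul_of_nonneg_left ?_ hC)
  -- rewrite the four sums of D3 in the regrouped form of `sobolev_sums_gen`
  have r1 : ∀ p : {s : EuclideanSpace ℝ (Fin 3) // s ∈ Sites₀ t A ∧ dist s c ≤ 5 * ℓ}, ∀ e : EuclideanSpace ℝ (Fin 3),
      ‖F ((p : EuclideanSpace ℝ (Fin 3)) + A e + A e₀) - F ((p : EuclideanSpace ℝ (Fin 3)) + A e) -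
        (F ((p : EuclideanSpace ℝ (Fin 3)) + A e₀) - F p)‖ ^ 2 =
      ‖(F ((p : EuclideanSpace ℝ (Fin 3)) + A e + A e₀) - F ((p : EuclideanSpace ℝ (Fin 3)) + A e)) -
        (F ((p : EuclideanSpace ℝ (Fin 3)) + A e₀) - F p)‖ ^ 2 := fun p e => rfl
  have r2 : ∀ p : {s : EuclideanSpace ℝ (Fin 3) // s ∈ Sites₀ t A ∧ dist s c ≤ 5 * ℓ}, ∀ e e' : EuclideanSpace ℝ (Fin 3),
      ‖F ((p : EuclideanSpace ℝ (Fin 3)) + A e + A e' + A e₀) - F ((p : EuclideanSpace ℝ (Fin 3)) + A e + A e') -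
        (F ((p : EuclideanSpace ℝ (Fin 3)) + A e + A e₀) - F ((p : EuclideanSpace ℝ (Fin 3)) + A e)) -
        (F ((p : EuclideanSpace ℝ (Fin 3)) + A e' + A e₀) - F ((p : EuclideanSpace ℝ (Fin 3)) + A e')) +
        (F ((p : EuclideanSpace ℝ (Fin 3)) + A e₀) - F p)‖ ^ 2 =
      ‖(F ((p : EuclideanSpace ℝ (Fin 3)) + A e + A e' + A e₀) - F ((p : EuclideanSpace ℝ (Fin 3)) + A e + A e')) -
        (F ((p : EuclideanSpace ℝ (Fin 3)) + A e + A e₀) - F ((p : EuclideanSpace ℝ (Fin 3)) + A e)) -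
        ((F ((p : EuclideanSpace ℝ (Fin 3)) + A e' + A e₀) - F ((p : EuclideanSpace ℝ (Fin 3)) + A e')) -
          (F ((p : EuclideanSpace ℝ (Fin 3)) + A e₀) - F p))‖ ^ 2 := by
    intro p e e'; congr 2; abel
  have r3 : ∀ p : {s : EuclideanSpace ℝ (Fin 3) // s ∈ Sites₀ t A ∧ dist s c ≤ 5 * ℓ}, ∀ e e' e'' : EuclideanSpace ℝ (Fin 3),
      ‖F ((p : EuclideanSpace ℝ (Fin 3)) + A e + A e' + A e'' + A e₀) - F ((p : EuclideanSpace ℝ (Fin 3)) + A e + A e' + A e'') -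
          (F ((p : EuclideanSpace ℝ (Fin 3)) + A e + A e' + A e₀) - F ((p : EuclideanSpace ℝ (Fin 3)) + A e + A e')) -
          (F ((p : EuclideanSpace ℝ (Fin 3)) + A e + A e'' + A e₀) - F ((p : EuclideanSpace ℝ (Fin 3)) + A e + A e'')) -
          (F ((p : EuclideanSpace ℝ (Fin 3)) + A e' + A e'' + A e₀) - F ((p : EuclideanSpace ℝ (Fin 3)) + A e' + A e'')) +
          (F ((p : EuclideanSpace ℝ (Fin 3)) + A e + A e₀) - F ((p : EuclideanSpace ℝ (Fin 3)) + A e)) +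
          (F ((p : EuclideanSpace ℝ (Fin 3)) + A e' + A e₀) - F ((p : EuclideanSpace ℝ (Fin 3)) + A e')) +
          (F ((p : EuclideanSpace ℝ (Fin 3)) + A e'' + A e₀) - F ((p : EuclideanSpace ℝ (Fin 3)) + A e'')) -
          (F ((p : EuclideanSpace ℝ (Fin 3)) + A e₀) - F p)‖ ^ 2 =
      ‖((F ((p : EuclideanSpace ℝ (Fin 3)) + A e + A e' + A e'' + A e₀) - F ((p : EuclideanSpace ℝ (Fin 3)) + A e + A e' + A e'')) -
            (F ((p : EuclideanSpace ℝ (Fin 3)) + A e + A e' + A e₀) - F ((p : EuclideanSpace ℝ (Fin 3)) + A e + A e')) -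
          ((F ((p : EuclideanSpace ℝ (Fin 3)) + A e + A e'' + A e₀) - F ((p : EuclideanSpace ℝ (Fin 3)) + A e + A e'')) -
            (F ((p : EuclideanSpace ℝ (Fin 3)) + A e + A e₀) - F ((p : EuclideanSpace ℝ (Fin 3)) + A e)))) -
          (((F ((p : EuclideanSpace ℝ (Fin 3)) + A e' + A e'' + A e₀) - F ((p : EuclideanSpace ℝ (Fin 3)) + A e' + A e'')) -
            (F ((p : EuclideanSpace ℝ (Fin 3)) + A e' + A e₀) - F ((p : EuclideanSpace ℝ (Fin 3)) + A e'))) -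
          ((F ((p : EuclideanSpace ℝ (Fin 3)) + A e'' + A e₀) - F ((p : EuclideanSpace ℝ (Fin 3)) + A e'')) -
            (F ((p : EuclideanSpace ℝ (Fin 3)) + A e₀) - F p)))‖ ^ 2 := by
    intro p e e' e''; congr 2; abel
  simp only [r2, r3]
  have hi3 : 0 ≤ (ℓ⁻¹) ^ 3 := by positivity
  have hi1 : 0 ≤ ℓ⁻¹ := by positivity
  have hl3 : 0 ≤ ℓ ^ 3 := by positivity
  exact add_le_add (add_le_add (add_le_add (mul_le_mul_of_nonneg_left h0 hi3) (mul_le_mul_of_nonneg_left h1 hi1))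
    (mul_le_mul_of_nonneg_left h2 hℓ0.le)) (mul_le_mul_of_nonneg_left h3 hl3)

end Blowdown

open LevelOne in
/-- **The Sobolev step for a generator difference** (registered sub-goal `blowdown_sobolevGen`, step (5) of stub
`stub_interior`, crux stmt-AtomisticToContinuum-9332, line `Sketch` v4): if the nearest-neighbour energies on
`B_{5ℓ+2}(c)` of `F` and of its `k`-fold generator differences (`k ≤ 3`) are bounded by `B₀, B₁, B₂, B₃`, then at
every site `p₀ ∈ B_ℓ(c)` (`ℓ ≥ 8`) and for every generator `e₀`,
`‖F(p₀ + A e₀) − F p₀‖² ≤ C(ℓ⁻³B₀ + ℓ⁻¹B₁ + ℓB₂ + ℓ³B₃)`. [folklore] -/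
theorem blowdown_sobolevGen : ∃ C : ℝ, 0 ≤ C ∧ ∀ (t : Fin 2 → (EuclideanSpace ℝ (Fin 3)))
    (A : (EuclideanSpace ℝ (Fin 3)) →L[ℝ] (EuclideanSpace ℝ (Fin 3))), Adm₀ A → Inner₀ t A →
    ∀ (F : (EuclideanSpace ℝ (Fin 3)) → (EuclideanSpace ℝ (Fin 3))) (c : (EuclideanSpace ℝ (Fin 3)))
      (ℓ B₀ B₁ B₂ B₃ : ℝ), 8 ≤ ℓ →
      Blowdown.nnEnergy (Sites₀ t A) F c (5 * ℓ + 2) ≤ B₀ →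
      (∀ e₁ ∈ ({triangularVec₁ 1, triangularVec₂ 1, layerNormal (2 * Real.sqrt (2 / 3))} :
          Finset (EuclideanSpace ℝ (Fin 3))),
        Blowdown.nnEnergy (Sites₀ t A) (fun x => F (x + A e₁) - F x) c (5 * ℓ + 2) ≤ B₁) →
      (∀ e₁ ∈ ({triangularVec₁ 1, triangularVec₂ 1, layerNormal (2 * Real.sqrt (2 / 3))} :
          Finset (EuclideanSpace ℝ (Fin 3))),
        ∀ e₂ ∈ ({triangularVec₁ 1, triangularVec₂ 1, layerNormal (2 * Real.sqrt (2 / 3))} :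
          Finset (EuclideanSpace ℝ (Fin 3))),
        Blowdown.nnEnergy (Sites₀ t A) (fun x => (F (x + A e₂ + A e₁) - F (x + A e₂)) - (F (x + A e₁) - F x))
          c (5 * ℓ + 2) ≤ B₂) →
      (∀ e₁ ∈ ({triangularVec₁ 1, triangularVec₂ 1, layerNormal (2 * Real.sqrt (2 / 3))} :
          Finset (EuclideanSpace ℝ (Fin 3))),
        ∀ e₂ ∈ ({triangularVec₁ 1, triangularVec₂ 1, layerNormal (2 * Real.sqrt (2 / 3))} :
          Finset (EuclideanSpace ℝ (Fin 3))),
        ∀ e₃ ∈ ({triangularVec₁ 1, triangularVec₂ 1, layerNormal (2 * Real.sqrt (2 / 3))} :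
          Finset (EuclideanSpace ℝ (Fin 3))),
        Blowdown.nnEnergy (Sites₀ t A) (fun x => ((F (x + A e₃ + A e₂ + A e₁) - F (x + A e₃ + A e₂)) -
          (F (x + A e₃ + A e₁) - F (x + A e₃))) - ((F (x + A e₂ + A e₁) - F (x + A e₂)) - (F (x + A e₁) - F x)))
          c (5 * ℓ + 2) ≤ B₃) →
      ∀ e₀ ∈ ({triangularVec₁ 1, triangularVec₂ 1, layerNormal (2 * Real.sqrt (2 / 3))} :
          Finset (EuclideanSpace ℝ (Fin 3))),
      ∀ p₀ ∈ Sites₀ t A, dist p₀ c ≤ ℓ →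
        ‖F (p₀ + A e₀) - F p₀‖ ^ 2 ≤ C * ((ℓ⁻¹) ^ 3 * B₀ + ℓ⁻¹ * B₁ + ℓ * B₂ + ℓ ^ 3 * B₃) := by
  obtain ⟨C_S, hS⟩ := blowdown_latticeSobolev3
  refine ⟨max C_S 0 * 108, by positivity, ?_⟩
  intro t A hA hI F c ℓ B₀ B₁ B₂ B₃ hℓ hB0 hB1 hB2 hB3 e₀ he₀ p₀ hp₀ hp₀c
  obtain ⟨gens, hgens⟩ : ∃ gens : Finset (EuclideanSpace ℝ (Fin 3)),
      gens = {triangularVec₁ 1, triangularVec₂ 1, layerNormal (2 * Real.sqrt (2 / 3))} := ⟨_, rfl⟩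
  rw [← hgens] at hB1 hB2 hB3 he₀
  have hS' := fun (G : EuclideanSpace ℝ (Fin 3) → EuclideanSpace ℝ (Fin 3)) (c : EuclideanSpace ℝ (Fin 3)) (ℓ : ℝ)
      (hℓ : 8 ≤ ℓ) (p₀ : EuclideanSpace ℝ (Fin 3)) (hp₀ : p₀ ∈ Sites₀ t A) (hp₀c : dist p₀ c ≤ ℓ) =>
    (hS t A hA hI G c ℓ hℓ p₀ hp₀ hp₀c).trans (mul_le_mul_of_nonneg_right (le_max_left C_S 0) (by
      have hℓ0 : 0 < ℓ := by linarith
      positivity))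
  have h := Blowdown.genDiff_sq_le hA hI hS' (le_max_right _ _) F c hℓ gens hgens he₀ hB0 hB1 hB2 hB3 hp₀ hp₀c
  refine h.trans ?_
  have hℓ0 : 0 < ℓ := by linarith
  have hm : 0 ≤ max C_S 0 := le_max_right _ _
  have hB0' : 0 ≤ B₀ := (Blowdown.nnEnergy_nonneg _ _ _ _).trans hB0
  have hB1' : 0 ≤ B₁ := (Blowdown.nnEnergy_nonneg _ _ _ _).trans (hB1 _ he₀)
  have hB2' : 0 ≤ B₂ := (Blowdown.nnEnergy_nonneg _ _ _ _).trans (hB2 _ he₀ _ he₀)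
  have h4 : 0 ≤ (ℓ⁻¹) ^ 3 * B₀ := by positivity
  have h5 : 0 ≤ ℓ⁻¹ * B₁ := by positivity
  have h6 : 0 ≤ ℓ * B₂ := by positivity
  nlinarith

end Summit.AtomisticToContinuum.Crystallization.Theorems.ExcessDecayLiouville

end
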